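import Summits.BirchSwinnertonDyer.BirchSwinnertonDyer.Theorems.ErratumRoadFiveNonSurjCornerKolyJProp44SuppliersZhang
import Summits.BirchSwinnertonDyer.BirchSwinnertonDyer.Theorems.ErratumRoadFiveNonSurjCornerKolyJProp44PairData
import Summits.BirchSwinnertonDyer.Rank1Residual.X11b.KolyvaginH37Bridge
import Summits.BirchSwinnertonDyer.Rank1Residual.X11b.KolyvaginHpointsAssembly
import Summits.BirchSwinnertonDyer.Rank1Residual.X11b.KolyvaginPointInertia
import HarnessLib

/-!
# McCallum 1991 Prop. 4.4 at `λ ∣ n` in ORDER form for TWO COMPATIBLE concrete Kolyvagin–Heegner data at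
# Zhang–Kolyvagin levels: `p^a c_M(n) ∈ Sel_λ ↔ p^a c_M(n/ℓ)_λ = 0`, modulo the congruence (γ) for the pair
# (cell `bsd-stepL`, seat `bsd-stepL-corner-p1` g10; `--supports stmt-BirchSwinnertonDyer-19947`; memo CORNER-G10 §1)

WHY/WHAT. The ONE corner-specific named input of `stub_kolyJ_max` (item 19947, child of 19065 `NonSurjCorner`)
is McCallum's Prop. 4.4 «in particular» WITHOUT the tower-surjectivity binder of the typed print fact
`McCallum1991.prop44_localOrder_kolyvaginClass_mul_eq` (memo CORNER-G9 §1–§3). x11b3's `h44` programme proves the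
order form `p^a c_M(m) ∈ Sel_λ ↔ p^a c_M(m/ℓ)_λ = 0` modulo the image-free congruence (γ) = Gross Prop. 3.7 (2), at
GROSS primes, for a coherent FAMILY on the divisors of one level (X11b/KolyvaginH44Concrete). This file is the same
theorem (i) at ZHANG–Kolyvagin levels (`Zhang2014.IsKolyvaginPrime (W.conductorNorm ℤ) W K p q ∧ M ≤ kolyvaginIndex`,
image-free: the pair-guarded END `Prop44.h44_of_prop37_at_zhang`, p536014 ∕ `…SuppliersZhang`), (ii) for TWO data
`d` (level `n`) and `d₀` (level `n/ℓ`) COMPATIBLE in the currency of the typed fact and of the corner's consumers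
(`d.σ q` restricts to `d₀.σ q`, `d.S` restricts onto `d₀.S`, `d.emb` restricts to `d₀.emb`; the coherence clause is
then a theorem: `Prop44.toGeomPoints_derivedPoint_map_of_compat`), (iii) with (γ) for THIS pair as the one labelled
input `hγ`, and the two standing inputs of McCallum's class at the two levels — `hA`∕`hA₀` (Gross Lemma 4.3 ∕ McCallum
(5): `E(K[·]) ⊆ E(K̄)` admissible for `p^M`) and `hPt`∕`hPt₀` (Gross Prop. 3.6: `[P(·)]` is `Γ_K`-invariant mod `p^M`)
— as hypotheses (theorems on the corner under (irr): `X11b.NoTorsionIrr`; discharged downstream). The level data,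
the Galois dictionary, `hI` (McCallum Lemma 4.3 at `v ∤ m`: x11b3's `smul_kolyvaginPoint_eq_of_mem_localInertia`), the
trace relation Prop. 3.7 (1) (x11b3's `HeegnerTrace.*` on the tree's `prop37_1_traceRelation_holds`) and the
identification of the END's classes with `KolyvaginHeegnerData.kolyvaginClass` are supplied inside, exactly as in
x11b3's `h44_concrete_of_traceRelation_of_congruence`. HONEST FRAMING: Prop. 4.4's order form for the corner modulo
(γ) (PRINT: Gross 1991 Prop. 3.7 (2), Eichler–Shimura; the tree's `GrossLMS1991.prop37_2_reductionCongruence`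
carries Gross's §2 surjectivity binder and is not usable on the corner); nothing about BSD; no stub closes; T7.
References: [McCallumLMS1991] §4 (4)–(6), Lemma 4.3, Prop. 4.4 (p. 301) and its proof (p. 302); [GrossLMS1991] §3
(3.1)–(3.5), Prop. 3.6, Prop. 3.7 (1)(2), §4 (4.1), Lemma 4.3, Prop. 6.2 (2), §1 (p. 235: `D ≠ 3, 4`);
[WZhang2014] Notations (xii).
-/

set_option autoImplicit false
set_option linter.dupNamespace false

noncomputable section

open scoped Classical
open WeierstrassCurve Field NumberField IsDedekindDomain Finset
open Literature.NumberTheory.EllipticCurves Literature.NumberTheory.GaloisRepresentations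
open Literature.NumberTheory.EllipticCurves.KolyvaginCocycle
open Literature.NumberTheory.EllipticCurves.KolyvaginEuler
open Literature.NumberTheory.EllipticCurves.RingClassField
open Literature.NumberTheory.EllipticCurves.ModularForms
open Summit.BirchSwinnertonDyer.Rank1Residual.X11b
open Summit.BirchSwinnertonDyer.Rank1Residual.X11b.KolyvaginTowerLift
open Summit.BirchSwinnertonDyer.Rank1Residual.X11b.RingClassTower
open Summit.BirchSwinnertonDyer.Rank1Residual.X11b.KolyvaginH44

namespace Summit.BirchSwinnertonDyer.BirchSwinnertonDyer.Theorems.Prop44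

-- `K : Type`: the tree's ring-class class field theory is universe `0`.
variable {K : Type} [Field K] [NumberField K] {W : WeierstrassCurve ℚ}

/-- **McCallum 1991, Prop. 4.4 at `λ ∣ n` in order form, for two COMPATIBLE concrete Kolyvagin–Heegner data at
Zhang–Kolyvagin levels, modulo the congruence (γ) for the pair.** `E = W/ℚ` globally minimal of conductor `N_E`, `K`
imaginary quadratic with `d_K < −4` and the Heegner hypothesis for `N_E`, a frame `(Dt, β, ι)`, `p` odd, `M ≥ 1`, a
square-free `n` whose prime factors are Zhang–Kolyvagin primes of index `≥ M`, a prime factor `ℓ` of `n`,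
`m = n/ℓ`, data `d` (level `n`) and `d₀` (level `m`) compatible along `K[m] ⊆ K[n] ⊆ ℂ` (`hσ`, `hS₁`, `hS₂`,
`hemb` — the binders of the typed Prop. 4.4 fact), the LABELLED congruence `hγ` = Gross Prop. 3.7 (2) for this pair
(*"`y_n ≡ Frob(λ_m)(y_m) (mod λ_n)`"*: for `ℓ ∤ Δ_W`, the `ℓ`-Frobenius `φ₀` and every `γ ∈ Gal(K[n]/K)`,
`red(γ·y(n)) = φ₀·red(γ·y(m)↑)` along the tree's place over `ℓ`), and McCallum's standing inputs at the two levels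
(`hA`, `hA₀`: admissibility; `hPt`, `hPt₀`: invariance mod `p^M`): for the place `λ ∋ ℓ` and every `a`,
**`p^a c_M(n) ∈ Sel_λ ↔ p^a c_M(m)_λ = 0`** for the concrete classes `d.kolyvaginClass hp M`, `d₀.kolyvaginClass hp M`.
[cite: McCallumLMS1991, Prop. 4.4 (p. 301), Lemma 4.3, §4 (4)–(6)] [cite: GrossLMS1991, Prop. 3.7 (1)(2), Prop. 3.6,
§4 (4.1), Lemma 4.3, Prop. 6.2 (2)] [cite: WZhang2014, Notations (xii)] -/
theorem zsmul_kolyvaginClass_mem_selmerLocalKer_iff_of_compat [W.IsElliptic] [W.IsGloballyMinimal]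
    [NeZero (W.conductorNorm ℤ)]
    (hK : IsImaginaryQuadratic K) (ι : K →+* ℂ) (hD : NumberField.discr K < -4)
    (hH : SatisfiesHeegnerHypothesis (W.conductorNorm ℤ) K)
    (Dt : ModularParametrizationData W (W.conductorNorm ℤ)) {β : ℤ}
    {p M : ℕ} (hp : p.Prime) (hp2 : p ≠ 2) (hM : 1 ≤ M)
    {n : ℕ} (hn : Squarefree n)
    (hkol : ∀ q ∈ n.primeFactors, Zhang2014.IsKolyvaginPrime (W.conductorNorm ℤ) W K p q ∧
      M ≤ Zhang2014.kolyvaginIndex W p q)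
    {ℓ : ℕ} (hℓ : ℓ ∈ n.primeFactors) {m : ℕ} (hmn : n / ℓ = m)
    (d : KolyvaginHeegnerData Dt β ι n) (d₀ : KolyvaginHeegnerData Dt β ι m)
    (hσ : ∀ q ∈ m.primeFactors, ∀ (x : ringClassField K ι m) (x' : ringClassField K ι n),
      (x : ℂ) = x' → ((d.σ q x' : ringClassField K ι n) : ℂ) = (d₀.σ q x : ℂ))
    (hS₁ : ∀ s ∈ d₀.S, ∃ s' ∈ d.S, ∀ (x : ringClassField K ι m) (x' : ringClassField K ι n),
      (x : ℂ) = x' → ((s' x' : ringClassField K ι n) : ℂ) = (s x : ℂ))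
    (hS₂ : ∀ s' ∈ d.S, ∃ s ∈ d₀.S, ∀ (x : ringClassField K ι m) (x' : ringClassField K ι n),
      (x : ℂ) = x' → ((s' x' : ringClassField K ι n) : ℂ) = (s x : ℂ))
    (hemb : ∀ (x : ringClassField K ι m) (x' : ringClassField K ι n),
      (x : ℂ) = x' → d.emb x' = d₀.emb x)
    (hγ : ∀ [Fact ℓ.Prime] (hΔ : ¬ (ℓ : ℤ) ∣ minimalDiscriminantInt W)
      (φ₀ : absoluteGaloisGroup (ZMod ℓ)), (∀ x : AlgebraicClosure (ZMod ℓ), φ₀ • x = x ^ ℓ) →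
      ∀ (hle : ringClassField K ι m ≤ ringClassField K ι n)
        (γ : ringClassField K ι n ≃ₐ[ℚ] ringClassField K ι n), γ ∈ ringClassGal ι n →
        geomReduction hΔ ((RatClosure.pointsEquiv (K := K) W).symm
            (d.toGeomPoints (pointGalHom W (ringClassField K ι n) γ d.y))) =
          φ₀ • geomReduction hΔ ((RatClosure.pointsEquiv (K := K) W).symm
            (d.toGeomPoints (pointGalHom W (ringClassField K ι n) γ
              (WeierstrassCurve.Affine.Point.map (W' := W)
                (letI : Algebra K ℂ := ι.toAlgebra; (RingClassField.inclusion ι hle).restrictScalars ℚ)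
                d₀.y)))))
    (hA : IsAdmissible (absoluteGaloisGroup K) d.pointsSubgroup ((p ^ M : ℕ) : ℤ))
    (hA₀ : IsAdmissible (absoluteGaloisGroup K) d₀.pointsSubgroup ((p ^ M : ℕ) : ℤ))
    (hPt : d.toGeomPoints d.derivedPoint ∈
      invPoints (absoluteGaloisGroup K) d.pointsSubgroup ((p ^ M : ℕ) : ℤ))
    (hPt₀ : d₀.toGeomPoints d₀.derivedPoint ∈
      invPoints (absoluteGaloisGroup K) d₀.pointsSubgroup ((p ^ M : ℕ) : ℤ))
    (v : HeightOneSpectrum (𝓞 K)) (hv : (ℓ : 𝓞 K) ∈ v.asIdeal) (a : ℕ) :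
    (((p : ℤ) ^ a) • d.kolyvaginClass hp M ∈
        selmerLocalKer (W.baseChange K) (v.adicCompletion K) ((p ^ M : ℕ) : ℤ) ↔
      ((p : ℤ) ^ a) • d₀.kolyvaginClass hp M ∈
        (W.baseChange K).torsionLocalKer (v.adicCompletion K) ((p ^ M : ℕ) : ℤ)) := by
  subst hmn
  letI : Algebra K ℂ := ι.toAlgebra
  set N : ℕ := W.conductorNorm ℤ with hNdef
  have hn0 : n ≠ 0 := Squarefree.ne_zero hn
  obtain ⟨hℓp, hℓn, -⟩ := Nat.mem_primeFactors.mp hℓ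
  haveI : Fact ℓ.Prime := ⟨hℓp⟩
  have hdvd : n / ℓ ∣ n := Nat.div_dvd_of_dvd hℓn
  have hm0 : n / ℓ ≠ 0 := (Nat.div_pos (Nat.le_of_dvd (Nat.pos_of_ne_zero hn0) hℓn) hℓp.pos).ne'
  have hmn : n / ℓ ≠ n := (Nat.div_lt_self (Nat.pos_of_ne_zero hn0) hℓp.one_lt).ne
  have hmsq : Squarefree (n / ℓ) := hn.squarefree_of_dvd hdvd
  have hℓm' : ¬ ℓ ∣ n / ℓ := not_dvd_div_of_squarefree_of_prime hn hℓp hℓn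
  have hle : ringClassField K ι (n / ℓ) ≤ ringClassField K ι n := ringClassField_mono hK ι hdvd hn0
  have hinert : ∀ q ∈ n.primeFactors, (Ideal.span {(q : 𝓞 K)}).IsPrime :=
    fun q hq ↦ (hkol q hq).1.2.2.2.2.1
  have hND : IsCoprime (N : ℤ) (NumberField.discr K) :=
    KolyvaginAssembly.isCoprime_discr_of_satisfiesHeegnerHypothesis hK hH
  have hℓN : ¬ ℓ ∣ N := (hkol ℓ hℓ).1.2.1
  have hNn : Nat.Coprime N n :=
    KolyvaginH37Bridge.coprime_of_forall_not_dvd hn0 fun q hq ↦ (hkol q hq).1.2.1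
  have hdiv : ∀ Q : geomPoints (W.baseChange K), ∃ R, ((p ^ M : ℕ) : ℤ) • R = Q :=
    (W.baseChange K).zsmul_geomPoints_surjective_of_charZero
      (by exact_mod_cast pow_ne_zero M hp.ne_zero)
  -- the two-level family
  let R : ℕ → Prop := fun k ↦ k = n ∨ k = n / ℓ
  let dfam : (k : ℕ) → R k → KolyvaginHeegnerData Dt β ι k := fun k hk ↦
    if h : k = n then h ▸ d else (hk.resolve_left h) ▸ d₀
  have hRn : R n := Or.inl rfl
  have hRm : R (n / ℓ) := Or.inr rfl
  have hdfam_n : ∀ h : R n, dfam n h = d := fun h ↦ by simp only [dfam, dif_pos rfl]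
  have hdfam_m : ∀ h : R (n / ℓ), dfam (n / ℓ) h = d₀ := fun h ↦ by simp only [dfam, dif_neg hmn]
  have hsqR : ∀ k, R k → Squarefree k := by
    rintro k (rfl | rfl)
    exacts [hn, hmsq]
  have hinertR : ∀ k, R k → ∀ q ∈ k.primeFactors, (Ideal.span {(q : 𝓞 K)}).IsPrime := by
    rintro k (rfl | rfl) q hq
    exacts [hinert q hq, hinert q (Nat.primeFactors_mono hdvd hn0 hq)]
  -- the level data, at every level
  choose σ H f y π j e hord hj hπρ hfsec hHρ hdict hjunk using
    fun k ↦ exists_levelData_of (W := W) (Dt := Dt) (β := β) hK ι R hsqR hinertR dfam k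
  -- `𝒢_k = ringClassGal ι k` is a finite commutative group acting on `E(K[k])` through `pointGalHom`
  letI hcg : ∀ k, CommGroup (ringClassGal ι k) := fun k ↦
    { (inferInstance : Group (ringClassGal ι k)) with
      mul_comm := fun a b ↦ (isMulCommutative_ringClassGal' hK ι k).is_comm.comm a b }
  haveI hfin : ∀ k, Finite (ringClassGal ι k) := finite_ringClassGal hK ι
  letI act : ∀ k, DistribMulAction (ringClassGal ι k)
      ((W.baseChange (ringClassField K ι k)).toAffine.Point) := fun k ↦
    DistribMulAction.compHom _ ((pointGalHom W (ringClassField K ι k)).comp (ringClassGal ι k).subtype)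
  letI hft : ∀ k, Fintype (ringClassGal ι k ⧸ H k) := fun k ↦ Fintype.ofFinite _
  -- the inclusion `ρ_k : 𝒢_k ≤ Aut_ℚ(K[k])`
  set ρ : ∀ k, ringClassGal ι k →* (ringClassField K ι k ≃ₐ[ℚ] ringClassField K ι k) :=
    fun k ↦ (ringClassGal ι k).subtype with hρdef
  have hρ : ∀ k, Function.Injective (ρ k) := fun k ↦ (ringClassGal ι k).subtype_injective
  have hsmul : ∀ (k) (g : ringClassGal ι k) (Q : (W.baseChange (ringClassField K ι k)).toAffine.Point),
      g • Q = pointGalHom W (ringClassField K ι k) (ρ k g) Q := fun _ _ _ ↦ rfl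
  have hj' : ∀ (k) (g : absoluteGaloisGroup K) (a : (W.baseChange (ringClassField K ι k)).toAffine.Point),
      j k (π k g • a) = g • j k a := fun k g a ↦ by rw [hsmul]; exact hj k g a
  -- the dictionary at the two levels
  have hjn : j n = d.toGeomPoints := by rw [(hdict n hRn).1, hdfam_n hRn]
  have hjm : j (n / ℓ) = d₀.toGeomPoints := by rw [(hdict (n / ℓ) hRm).1, hdfam_m hRm]
  have hyn : y n = d.y := by rw [(hdict n hRn).2.1, hdfam_n hRn]
  have hym : y (n / ℓ) = d₀.y := by rw [(hdict (n / ℓ) hRm).2.1, hdfam_m hRm]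
  have hσn : ∀ q ∈ n.primeFactors, ρ n (σ n q) = d.σ q := fun q hq ↦ by
    have h := (hdict n hRn).2.2.1 q hq
    rwa [hdfam_n hRn] at h
  have hσm : ∀ q ∈ (n / ℓ).primeFactors, ρ (n / ℓ) (σ (n / ℓ) q) = d₀.σ q := fun q hq ↦ by
    have h := (hdict (n / ℓ) hRm).2.2.1 q hq
    rwa [hdfam_m hRm] at h
  have hfSn : ∀ c, ρ n (f n c) ∈ d.S := fun c ↦ by
    have h := (hdict n hRn).2.2.2 c
    rwa [hdfam_n hRn] at h
  have hfSm : ∀ c, ρ (n / ℓ) (f (n / ℓ) c) ∈ d₀.S := fun c ↦ by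
    have h := (hdict (n / ℓ) hRm).2.2.2 c
    rwa [hdfam_m hRm] at h
  -- the abstract Kolyvagin point IS `P(k)` at the two levels (x11b3-p8's G1)
  have hbij : ∀ (k : ℕ) (dk : KolyvaginHeegnerData Dt β ι k), (∀ c, ρ k (f k c) ∈ dk.S) →
      Set.BijOn (fun c : ringClassGal ι k ⧸ H k ↦ ρ k (f k c)) Set.univ (dk.S : Set _) :=
    fun k dk hfS ↦ KolyvaginH37Bridge.bijOn_of_section_of_transversal (ρ k) (hρ k)
      (H := H k) (Γ := ringClassGal ι k) (G₁ := ringClassGalOver ι k 1) (hHρ k)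
      (S := (dk.S : Set _)) (fun s hs ↦ dk.S_subset s hs)
      (fun s hs ↦ ⟨⟨s, dk.S_subset s hs⟩, rfl⟩) dk.S_transversal (f k) (hfsec k) hfS
  have hPn : j n (kolyvaginPoint (σ n) n.primeFactors (f n) (y n)) = d.toGeomPoints d.derivedPoint := by
    rw [hjn, hyn]
    congr 1
    exact KolyvaginH37Bridge.map_kolyvaginPoint_eq_derivedPoint
      (pointGalHom W (ringClassField K ι n)) (ρ n) (AddMonoidHom.id _) (fun g a ↦ hsmul n g a)
      hn hσn (f n) (hbij n d hfSn) d.y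
  have hPm : j (n / ℓ) (kolyvaginPoint (σ (n / ℓ)) (n / ℓ).primeFactors (f (n / ℓ)) (y (n / ℓ))) =
      d₀.toGeomPoints d₀.derivedPoint := by
    rw [hjm, hym]
    congr 1
    exact KolyvaginH37Bridge.map_kolyvaginPoint_eq_derivedPoint
      (pointGalHom W (ringClassField K ι (n / ℓ))) (ρ (n / ℓ)) (AddMonoidHom.id _)
      (fun g a ↦ hsmul (n / ℓ) g a) hmsq hσm (f (n / ℓ)) (hbij (n / ℓ) d₀ hfSm) d₀.y
  -- the END's structural hypotheses `hA`, `hPt`, `hI` at every level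
  have hA' : ∀ k, IsAdmissible (absoluteGaloisGroup K) (j k).range ((p ^ M : ℕ) : ℤ) := by
    intro k
    by_cases hk : R k
    · rcases hk with rfl | rfl
      · rw [hjn]; exact hA
      · rw [hjm]; exact hA₀
    · rw [hjunk k hk]
      refine ⟨fun g a ha ↦ ?_, fun a ha _ ↦ ?_⟩
      · obtain ⟨x, hx⟩ := ha
        rw [AddMonoidHom.zero_apply] at hx
        rw [← hx, smul_zero]
        exact AddSubgroup.zero_mem _
      · obtain ⟨x, hx⟩ := ha
        rw [AddMonoidHom.zero_apply] at hx
        exact hx.symm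
  have hPt' : ∀ k, j k (kolyvaginPoint (σ k) k.primeFactors (f k) (y k)) ∈
      invPoints (absoluteGaloisGroup K) (j k).range ((p ^ M : ℕ) : ℤ) := by
    intro k
    by_cases hk : R k
    · rcases hk with rfl | rfl
      · rw [hPn, hjn]; exact hPt
      · rw [hPm, hjm]; exact hPt₀
    · rw [hjunk k hk, AddMonoidHom.zero_apply]; exact AddSubgroup.zero_mem _
  have hI' := smul_kolyvaginPoint_eq_of_mem_localInertia (W := W) hK ι σ (fun k ↦ k.primeFactors) H f y
    π j hj' e ρ hρ hπρ
  -- the pair guard, `hσρ` and `h37` at the pair `(n, ℓ)`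
  let Rp : ℕ → ℕ → Prop := fun k q ↦ k = n ∧ q = ℓ
  have hσρ : ∀ k : ℕ, ∀ q ∈ k.primeFactors, Rp k q →
      (Subgroup.zpowers (σ k q)).map (ρ k) = ringClassGalOver ι k (k / q) := by
    rintro k q hq ⟨hk, hq'⟩
    subst k; subst q
    rw [MonoidHom.map_zpowers, hσn ℓ hℓ, d.zpowers_σ ℓ hℓ]
  have hgood : W.HasGoodReductionAtPrime ℓ :=
    KolyvaginH37Bridge.hasGoodReductionAtPrime_of_modularParametrizationData Dt hℓN
  -- the witness `y' = y(n/ℓ)↑` read in `E(K[n])`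
  set y₀ : (W.baseChange (ringClassField K ι n)).toAffine.Point :=
    WeierstrassCurve.Affine.Point.map (W' := W)
      ((RingClassField.inclusion ι hle).restrictScalars ℚ) d₀.y with hy₀
  have h37 : ∀ k : ℕ, Squarefree k →
      (∀ q ∈ k.primeFactors, Zhang2014.IsKolyvaginPrime (W.conductorNorm ℤ) W K p q ∧
        M ≤ Zhang2014.kolyvaginIndex W p q) →
      ∀ q : ℕ, q.Prime → q ∣ k → Rp k q →
      q ∈ k.primeFactors ∧ ∃ y' : (W.baseChange (ringClassField K ι k)).toAffine.Point,
        j k (kolyvaginPoint (σ k) (k.primeFactors.erase q) (f k) y') =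
          j (k / q) (kolyvaginPoint (σ (k / q)) (k / q).primeFactors (f (k / q)) (y (k / q))) ∧
        grAct _ (traceElt (σ k q) q) (y k) = W.frobeniusTrace q • y' ∧
        ∀ [Fact q.Prime] (hΔ : ¬ (q : ℤ) ∣ minimalDiscriminantInt W)
          (φ₀ : absoluteGaloisGroup (ZMod q)), (∀ x : AlgebraicClosure (ZMod q), φ₀ • x = x ^ q) →
          ∀ γ : ringClassGal ι k, geomReduction hΔ ((RatClosure.pointsEquiv (K := K) W).symm (j k (γ • y k))) =
            φ₀ • geomReduction hΔ ((RatClosure.pointsEquiv (K := K) W).symm (j k (γ • y'))) := by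
    rintro k - - q - - ⟨hk, hq'⟩
    subst k; subst q
    refine ⟨hℓ, y₀, ?_, ?_, ?_⟩
    · -- (β1): G1 at both levels + the coherence clause, a THEOREM for compatible data
      have hG1 : kolyvaginPoint (σ n) (n / ℓ).primeFactors (f n) y₀ =
          KolyvaginOperator.derivedPoint (pointGalHom W (ringClassField K ι n)) d.σ (n / ℓ) d.S y₀ :=
        KolyvaginH37Bridge.map_kolyvaginPoint_eq_derivedPoint (pointGalHom W (ringClassField K ι n)) (ρ n)
          (AddMonoidHom.id _) (fun g a ↦ hsmul n g a) hmsq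
          (fun q hq ↦ hσn q (Nat.primeFactors_mono hdvd hn0 hq)) (f n) (hbij n d hfSn) y₀
      rw [hPm, hjn, ← primeFactors_div_eq_erase hn hℓp hℓn, hG1]
      exact toGeomPoints_derivedPoint_map_of_compat hK ι hn hℓ hle d d₀ hσ hS₁ hS₂ hemb
    · -- (β2): Prop. 3.7 (1) for the tree's data
      have htr := HeegnerTrace.frobeniusTrace_smul_eq_of_lFunction_smul_eq hgood
        (HeegnerTrace.sum_pow_pointGalHom_y_eq_lFunction_smul_map hK ι hND hℓ (hinert ℓ hℓ)
          hℓN hℓm' hNn (Or.inr hD) d d₀ hle)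
      rw [grAct_traceElt]
      simp_rw [hsmul n, map_pow (ρ n), hσn ℓ hℓ, hyn]
      exact htr
    · -- (γ): the labelled congruence for the pair, read through the dictionary
      intro _ hΔ φ₀ hφ₀ γ
      rw [hjn, hsmul, hsmul, hyn]
      exact hγ hΔ φ₀ hφ₀ hle (ρ n γ) γ.2
  -- the END at the pair `(n, ℓ)`
  have hEND := h44_of_prop37_at_zhang (W := W) hK ι hp hp2 hM hdiv σ (fun k ↦ k.primeFactors) H f
    (fun k q hq ↦ hord k q hq) y π j hj' hA' hPt' hI' Rp h37 e ρ hρ hπρ hσρ n hn hkol ℓ hℓp hℓn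
    ⟨rfl, rfl⟩ v hv a
  -- the END's classes are the concrete classes `c_M(n)`, `c_M(n/ℓ)`
  have hcn : d.kolyvaginClass hp M =
      kolyvaginClass (W.baseChange K) ((p ^ M : ℕ) : ℤ) hdiv (hA' n)
        (j n (kolyvaginPoint (σ n) n.primeFactors (f n) (y n))) (hPt' n) := by
    rw [KolyvaginHeegnerData.kolyvaginClass_of_admissible _ hp M hA hPt]
    exact kolyvaginClass_congr (by rw [hjn]; rfl) hPn.symm
  have hcm : d₀.kolyvaginClass hp M =
      kolyvaginClass (W.baseChange K) ((p ^ M : ℕ) : ℤ) hdiv (hA' (n / ℓ))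
        (j (n / ℓ) (kolyvaginPoint (σ (n / ℓ)) (n / ℓ).primeFactors (f (n / ℓ)) (y (n / ℓ))))
        (hPt' (n / ℓ)) := by
    rw [KolyvaginHeegnerData.kolyvaginClass_of_admissible _ hp M hA₀ hPt₀]
    exact kolyvaginClass_congr (by rw [hjm]; rfl) hPm.symm
  rw [hcn, hcm]
  exact hEND

end Summit.BirchSwinnertonDyer.BirchSwinnertonDyer.Theorems.Prop44

end
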